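import Summits.CriticalPhenomena.PercolationContinuityZ3.Theorems.Transplant.SkelConcAssemblyG
import Summits.CriticalPhenomena.PercolationContinuityZ3.Theorems.Transplant.SkelKitResidues
import Summits.CriticalPhenomena.PercolationContinuityZ3.Theorems.Transplant.SkelChainUP
import Summits.CriticalPhenomena.PercolationContinuityZ3.Theorems.Transplant.SkelScales
import HarnessLib

/-!
# L7.3 — the generic (D) PARTIAL CLOSURE at `Skel.cellGeomSG`, run-restricted form: **`samePDropOfSkeletonConcLt_of_concSG_residuesR`** —
# the node of record `SamePDropOfSkeletonConcLt` modulo the three instance RESIDUES `Skel.RootOblT` (root probe, D8), `Skel.FaceOblR` (faces),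
# `Skel.ReachOblR` (corridors) at the concentric scheme `concSchemeSG Φ C t Λ q δ`, with the p-free constants (`SkelChainUP`), Step I at `p`
# (p3-g4's `Skel.exists_inputs_at_p`, the input family `Skel.inputEvent` over `Φ.types × S × Option (HOct 2)`) and the residue packaging
# (`Skel.kitAtRun_of_oblR`) DISCHARGED — generic twin of `BoxProdZ2.thetaDropBoxProdZ2_of_concG_residuesR` (BoxProdZ2ConcClosureRun p224455)

builds on p205010 (kernel theorem, internal audit signed; external expert review pending) — nothing in this file uses p205010.
Status sentence (coordinator 2026-08-20T04:30Z): "θ(p_c) = 0 on ℤ^d, all d ≥ 2 — kernel-verified (Lean 4/Mathlib, standard axioms); internal adversarial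
audit SIGNED 2026-08-20 04:29Z; external expert review pending."
Lane `prim-bschramm-*`, seat `prim-bschramm-stmt` (gen 7); helper file (`--supports stmt-CriticalPhenomena-4575`).
What the instance (the three residue seats + the generic `concChoice`) still owes, for handed p-free constants `K₀ δ δ₂ δr`, at a CENTRED skeleton
(`Φ.φ t = 0`, WLOG by `PlanarSkeletonConcShift`), `0 < p < 1`, `Φ.CylSubcritical p`: an input accuracy `δin > 0` and a minimal inner size `m₀`;
then for the inner sizes `msel` / threshold `M₀` that Step I produces, a finite scale set `S ⊆ [M₀, ∞)`; then for every running `q ∈ [p/2, p]` at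
which the inputs over `Φ.types × S` hold with accuracy `δin` and `Φ.CylSubcritical q`: planar cells `C` with `K₀ ≤ C.K`, a schedule `Λ` with
`Skel.WFS C Λ`, and the three residues at `concSchemeSG Φ C t Λ q δ` with degree parameter `Φ.Δ`.
Differences from the product: no `Infinite`, no quasi-transitivity, no amenability (the node's binders), `V₀ := Φ.types` (fixed by `SkelScales`),
`p < 1` is a binder (not `lt_one_of_tubeSubcritical`), the degree bound is the field `Φ.Δ` (not `hqt.exists_degree_le`), and the step / chain
properties are supplied for EVERY window graph `Skel.winGraph G c Rπ ≤ G` by `Φ.apply_step_UP` / `Φ.chain_edge_UP`.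
[cite: KozmaNitzan2024, §4 Theorem 6 (pp. 25–31); §1 p. 2 (approach 1)] [cite: GrimmettPercolation1999, §7.3 pp. 162, 169]
-/

noncomputable section

open MeasureTheory ProbabilityTheory
open scoped ENNReal Classical

namespace Summit.CriticalPhenomena.PercolationContinuityZ3.Theorems

namespace Transplant

namespace SkelConc

open Literature.Probability.Percolation Literature.Probability.LatticeModels SimpleGraph KNCells
open Literature.Probability.Percolation.GM (HOct)
open BoxProdZ2 (ConcRadiiG)

/-- **THE GENERIC (D) PARTIAL CLOSURE, run-restricted form**: the node of record from the three instance residues `Skel.RootOblT` (D8),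
`Skel.FaceOblR`, `Skel.ReachOblR` at the concentric scheme over the cell geometry of record (constants `K₀ δ δ₂ δr` handed p-free; input family
(A) discharged by Step I; centred skeletons). [cite: KozmaNitzan2024, §4 Theorem 6 (pp. 25–31); §1 p. 2 (approach 1)] -/
theorem samePDropOfSkeletonConcLt_of_concSG_residuesR
    (hres : ∀ (K₀ : ℕ) (δ δ₂ : ℝ) (δr : ℕ → ℝ), 0 < δ → δ ≤ 1 → 0 < δ₂ → δ₂ ≤ 1 → (∀ n, 0 < δr n ∧ δr n ≤ 1) →
      ∀ {V : Type} [DecidableEq V] [Countable V] (G : SimpleGraph V) [G.LocallyFinite] (Φ : PlanarSkeletonConc G),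
        G.Connected → ∀ t ∈ Φ.types, Φ.φ t = 0 → ∀ (p : unitInterval), 0 < (p : ℝ) → (p : ℝ) < 1 →
          ∀ (hC : Φ.toPlanarSkeleton.CylSubcritical p),
          ∃ (δin : ℝ) (m₀ : ℕ), 0 < δin ∧
            ∀ (msel : V → ℕ) (M₀ : ℕ), (∀ τ ∈ Φ.types, m₀ ≤ msel τ ∧ msel τ < M₀) →
              ∃ S : Finset ℕ, (∀ M ∈ S, M₀ ≤ M) ∧
                ∀ q : unitInterval, (p : ℝ) / 2 ≤ q → (q : ℝ) ≤ p →
                  (∀ i ∈ Skel.inputIndex Φ S, 1 - δin < (bondPercolation G q).real (Skel.inputEvent Φ hC msel i)) →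
                  Φ.toPlanarSkeleton.CylSubcritical q →
                    ∃ (C : PCells) (Λ : ConcRadiiG), Skel.WFS C Λ ∧ K₀ ≤ C.K ∧
                      Skel.RootOblT G (concSchemeSG Φ C t Λ q δ) Φ.Δ δr ∧
                      Skel.FaceOblR Φ (concSchemeSG Φ C t Λ q δ) (Skel.faceDataSG Φ C t Λ) Φ.Δ δ₂ ∧
                      Skel.ReachOblR Φ (concSchemeSG Φ C t Λ q δ) (Skel.faceDataSG Φ C t Λ) Φ.Δ δ) :
    SamePDropOfSkeletonConcLt := by
  refine samePDropOfSkeletonConcLt_of_concSG_inputs fun {V} _ _ G _ Φ hc t ht h0 p hp1 hU hC hθ => ?_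
  -- the p-free constants (`Φ.Δ` is the degree parameter)
  have hε' : (0 : ℝ) < (1 / 2) ^ 35 := by positivity
  obtain ⟨δ, hδ0, hδ1, hchain⟩ := Φ.chain_edge_UP ChainPlanar.Sched.nLast hε'
  obtain ⟨δ₂, hδ₂0, hδ₂1, hstep⟩ := Φ.apply_step_UP (half_pos hδ0)
  have hrc := fun n : ℕ => Φ.chain_edge_UP n hδ0
  choose δr hδr0 hδr1 hchainr using hrc
  obtain ⟨K₀, hK₀⟩ := exists_pow_lt_of_lt_one hε' (show 1 - δ₂ < 1 by linarith)
  have hp0 : 0 < (p : ℝ) := pos_of_theta_pos G t hθ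
  -- the instance at `p`
  obtain ⟨δin, m₀, hδin, hS⟩ := hres K₀ δ δ₂ δr hδ0 hδ1 hδ₂0 hδ₂1 (fun n => ⟨hδr0 n, hδr1 n⟩) G Φ hc t ht h0 p hp0 hp1 hC
  -- Step I at `p`: the inputs hold (`Skel.exists_inputs_at_p`)
  obtain ⟨msel, M₀, hmsel, hstd⟩ := Skel.exists_inputs_at_p Φ hp1 hθ hC hU hδin m₀
  obtain ⟨S, hSM, hB⟩ := hS msel M₀ hmsel
  -- (A): the input family
  refine ⟨V × ℕ × Option (HOct 2), Skel.inputIndex Φ S, Skel.inputEvent Φ hC msel, Skel.inputEdges Φ hC, fun _ => 1 - δin,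
    fun i _ => Skel.determinedBy_inputEvent Φ hC msel i, hstd S hSM, fun q hq1 hq2 hcq hCq => ?_⟩
  -- (B) at `q`
  have hq1' : (q : ℝ) < 1 := lt_of_le_of_lt hq2 hp1
  obtain ⟨C, Λ, hΛ, hK, hroot, hfaceO, hreachO⟩ := hB q hq1 hq2 hcq hCq
  refine ⟨C, Λ, δ, (1 / 2) ^ 35, δ₂, hΛ, hδ1, hε'.le, hδ₂1, ?_, ?_⟩
  · -- `4((1-δ₂)^K + 2⁻³⁵) ≤ 2⁻³²` since `K ≥ K₀`
    have hKpow : (1 - δ₂) ^ C.K ≤ (1 / 2 : ℝ) ^ 35 :=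
      (pow_le_pow_of_le_one (by linarith) (by linarith) hK).trans hK₀.le
    have h32 : (4 : ℝ) * ((1 / 2) ^ 35 + (1 / 2) ^ 35) = (1 / 2) ^ 32 := by norm_num
    show 4 * ((1 - δ₂) ^ C.K + (1 / 2 : ℝ) ^ 35) ≤ (1 / 2) ^ 32
    linarith
  · exact Skel.kitAtRun_of_oblR (S := concSchemeSG Φ C t Λ q δ) le_rfl
      (fun c Rπ => hstep q hq1' (Skel.winGraph G c Rπ) (Skel.winGraph_le G c Rπ))
      (fun c Rπ => hchain q hq1' (Skel.winGraph G c Rπ) (Skel.winGraph_le G c Rπ))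
      (fun n c Rπ => hchainr n q hq1' (Skel.winGraph G c Rπ) (Skel.winGraph_le G c Rπ)) hroot hfaceO hreachO

end SkelConc

end Transplant

end Summit.CriticalPhenomena.PercolationContinuityZ3.Theorems

end
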